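import Summits.QuantumFields.YangMills.Theorems.AllWindowsColdBoxBoxHighLineOrbitJacobianFinal
import Summits.QuantumFields.YangMills.Theorems.AllWindowsColdBoxBoxHighLineOrbitMapContraction
import Summits.QuantumFields.YangMills.Theorems.AllWindowsColdBoxBoxHighLineOrbitMapBulkSurjAssembly

/-!
# T-S5.4J UNCONDITIONAL, BY NAME: `orbitNormaliserJacobianR : OrbitNormaliserJacobianR`

The one-line composition of the conditional closer ✓`OrbitJacobian.orbitNormaliserJacobianR_of` (fcl-p3, `…OrbitJacobianFinal`)
with the three landed bricks J1 ✓`OrbitChart.orbitMapJacobianDet` (w3, `…SmearedFPOrbitJacobian`), J2 ✓`orbitMapContraction`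
(w2, `…OrbitMapContraction`) and J4 ✓`orbitMapBulkSurj_of_J1_J2` (w4, `…OrbitMapBulkSurjAssembly`).  Target letters:
`Cruxes/BoxWindowHighSU2213/TaskS5LaplaceR.lean` (planner ym-idea-2 g18, amendment (A)); the Prop is ✓`…OrbitJacobianDefs.OrbitNormaliserJacobianR`.

HONEST LABEL: this closes the support task T-S5.4J of LINE-19 step (1c) only; S5 (⟨stmt-QuantumFields-24004⟩/⟨24335⟩), U5 (⟨24336⟩) and the
route AllWindowsColdBox (DRAFT) remain OPEN; the Yang–Mills mass gap is NOT proved by this file; no summit is proved by a line.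
-/

set_option autoImplicit false

namespace Summit.QuantumFields.YangMills.Theorems.AllWindowsColdBoxBoxHighLine

/-- ★★★ **T-S5.4J (Jacobian form of the orbit-normaliser Laplace asymptotics), unconditional**: there are `C, c > 0` such that in the
window `C·H¹²(1+log β)⁸ ≤ β`, for Landau-gauge `V` with links within `r₀²` of `1` (`C r₀ H² ≤ 1`) and any cut-off radius `r` with
`r₀ + 1/(H⁴(1+log β)²) ≤ r`, `C r H ≤ 1`, the Jacobian-weighted orbit average satisfies `|N_J(V)/Z₀ − 1| ≤ e^{−cH⁴}`.
Composition of ✓`OrbitJacobian.orbitNormaliserJacobianR_of` with J1 ✓`OrbitChart.orbitMapJacobianDet`, J2 ✓`orbitMapContraction`,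
J4 ✓`orbitMapBulkSurj_of_J1_J2`. [folklore] -/
theorem orbitNormaliserJacobianR : OrbitNormaliserJacobianR :=
  OrbitJacobian.orbitNormaliserJacobianR_of OrbitChart.orbitMapJacobianDet orbitMapContraction
    (orbitMapBulkSurj_of_J1_J2 OrbitChart.orbitMapJacobianDet orbitMapContraction)


section LogForm

open Literature.MathematicalPhysics.QuantumFieldTheory.AxialGauge (boxEdges)
open Literature.MathematicalPhysics.QuantumLattice (LGConfig)

/-! ## Log / tilt form (the input of the STEP-2 packaging T-S5.5J)

From `|N_J/Z₀ − 1| ≤ δ := e^{−cH⁴} ≤ e^{−c} < 1` one gets `N_J > 0` and `|log(N_J/Z₀)| ≤ δ/(1 − δ) ≤ K·δ`, `K = (1 − e^{−c})⁻¹`;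
the constant `K` is absorbed into the window constant (`C ↦ max C K` only strengthens the hypotheses).  So the gauge-fixed measure
with the orbit normaliser in the denominator is a tilt `exp(W)`, `W = log(Z₀/N_J)`, `sup |W| ≤ C·e^{−cH⁴}`, of the one without it. -/

/-- `Z₀ > 0`. [folklore] -/
theorem laplaceZ0_pos (H : ℕ) {β : ℝ} (hβ : 0 < β) : 0 < laplaceZ0 β H := by
  unfold laplaceZ0
  have h1 : 0 < (2 * Real.pi ^ 2)⁻¹ := by positivity
  have h2 : 0 < Real.pi / β := div_pos Real.pi_pos hβ
  exact mul_pos (pow_pos h1 _) (Real.rpow_pos_of_pos h2 _)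

/-- `|x − 1| ≤ δ < 1` ⇒ `0 < x` and `|log x| ≤ δ/(1 − δ)`. [folklore] -/
theorem abs_log_le_div_of_abs_sub_one_le {x δ : ℝ} (h : |x - 1| ≤ δ) (hδ : δ < 1) :
    0 < x ∧ |Real.log x| ≤ δ / (1 - δ) := by
  have h1 : 1 - δ ≤ x := by linarith [(abs_le.1 h).1]
  have h2 : x ≤ 1 + δ := by linarith [(abs_le.1 h).2]
  have hx : 0 < x := by linarith
  have hδ0 : 0 ≤ δ := (abs_nonneg _).trans h
  have h1δ : 0 < 1 - δ := by linarith
  refine ⟨hx, abs_le.2 ⟨?_, ?_⟩⟩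
  · -- `log x ≥ 1 − 1/x ≥ 1 − 1/(1 − δ) = −δ/(1 − δ)`
    have hlow := Real.one_sub_inv_le_log_of_pos hx
    have hinv : x⁻¹ ≤ (1 - δ)⁻¹ := by
      rw [inv_le_inv₀ hx h1δ]; exact h1
    have : -(δ / (1 - δ)) = 1 - (1 - δ)⁻¹ := by field_simp; ring
    rw [this]; linarith
  · -- `log x ≤ x − 1 ≤ δ ≤ δ/(1 − δ)`
    have hup := Real.log_le_sub_one_of_pos hx
    have : δ ≤ δ / (1 - δ) := by
      rw [le_div_iff₀ h1δ]; nlinarith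
    linarith

/-- ★ **T-S5.4J in log / tilt form**: in the window, `N_J(V) > 0` and `|log(N_J(V)/Z₀)| ≤ C·e^{−cH⁴}` — the orbit normaliser is a
tilt `e^{W}`, `sup|W| ≤ C e^{−cH⁴}`, which is what the covariance book-keeping ✓`WeakCouplingRates.abs_cov_tilted_sub_le` consumes
(STEP-2 §2(c), brick T-S5.5J).  From ✓`orbitNormaliserJacobianR` and `abs_log_le_div_of_abs_sub_one_le`. [folklore] -/
theorem orbitNormaliserJacobianR_log :
    ∃ C c : ℝ, 0 < C ∧ 0 < c ∧ ∀ H : ℕ, 1 ≤ H → ∀ β r₀ r : ℝ, 2 ≤ β →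
    C * (H : ℝ) ^ 12 * (1 + Real.log β) ^ 8 ≤ β →
    0 ≤ r₀ → C * r₀ * (H : ℝ) ^ 2 ≤ 1 →
    r₀ + 1 / ((H : ℝ) ^ 4 * (1 + Real.log β) ^ 2) ≤ r → C * r * H ≤ 1 →
    ∀ V : LGConfig 4 SU2, InLandauGauge H V → (∀ e ∈ boxEdges 4 (2 * H + 1), linkDefect V e ≤ r₀ ^ 2) →
      0 < orbitAverage H (jacWeight β H r) V ∧
      |Real.log (orbitAverage H (jacWeight β H r) V / laplaceZ0 β H)| ≤ C * Real.exp (-(c * (H : ℝ) ^ 4)) := by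
  obtain ⟨C, c, hC, hc, hR⟩ := orbitNormaliserJacobianR
  -- `K = (1 − e^{−c})⁻¹`, new window constant `max C K`
  have hec : Real.exp (-c) < 1 := by
    have := Real.exp_lt_exp.2 (show -c < 0 by linarith); simpa using this
  set K : ℝ := (1 - Real.exp (-c))⁻¹ with hK
  have hK0 : 0 < K := by rw [hK]; exact inv_pos.2 (by linarith)
  refine ⟨max C K, c, lt_max_of_lt_left hC, hc, ?_⟩
  intro H hH β r₀ r hβ hwin hr₀ hr₀C hgap hrC V hV hlinks
  have hCle : C ≤ max C K := le_max_left _ _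
  have hHr : (1 : ℝ) ≤ (H : ℝ) := by exact_mod_cast hH
  have hL : 0 ≤ 1 + Real.log β := by linarith [Real.log_nonneg (show (1 : ℝ) ≤ β by linarith)]
  have hr : 0 ≤ r := by
    have : 0 ≤ 1 / ((H : ℝ) ^ 4 * (1 + Real.log β) ^ 2) := by positivity
    linarith
  -- the hypotheses with the smaller constant `C`
  have hwin' : C * (H : ℝ) ^ 12 * (1 + Real.log β) ^ 8 ≤ β :=
    le_trans (by gcongr) hwin
  have hr₀C' : C * r₀ * (H : ℝ) ^ 2 ≤ 1 := le_trans (by gcongr) hr₀C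
  have hrC' : C * r * H ≤ 1 := le_trans (by gcongr) hrC
  have hmain := hR H hH β r₀ r hβ hwin' hr₀ hr₀C' hgap hrC' V hV hlinks
  -- `δ = e^{−cH⁴} ≤ e^{−c} < 1`
  set δ : ℝ := Real.exp (-(c * (H : ℝ) ^ 4)) with hδ
  have hδle : δ ≤ Real.exp (-c) := by
    rw [hδ]; apply Real.exp_le_exp.2
    have : c * 1 ≤ c * (H : ℝ) ^ 4 := by
      apply mul_le_mul_of_nonneg_left _ hc.le; nlinarith [pow_le_pow_left₀ zero_le_one hHr 4]
    linarith
  have hδ1 : δ < 1 := lt_of_le_of_lt hδle hec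
  have hZ0 : 0 < laplaceZ0 β H := laplaceZ0_pos H (by linarith)
  obtain ⟨hx, hlog⟩ := abs_log_le_div_of_abs_sub_one_le hmain hδ1
  refine ⟨?_, hlog.trans ?_⟩
  · have := mul_pos hx hZ0
    rwa [div_mul_cancel₀ _ hZ0.ne'] at this
  · -- `δ/(1 − δ) ≤ K δ ≤ max C K · δ`
    have hδ0 : 0 < δ := Real.exp_pos _
    have h1 : 0 < 1 - Real.exp (-c) := by linarith
    calc δ / (1 - δ) ≤ δ / (1 - Real.exp (-c)) := by
          apply div_le_div_of_nonneg_left hδ0.le h1; linarith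
      _ = K * δ := by rw [hK]; ring
      _ ≤ max C K * δ := by gcongr; exact le_max_right _ _

end LogForm

end Summit.QuantumFields.YangMills.Theorems.AllWindowsColdBoxBoxHighLine
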